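import Literature.MathematicalPhysics.QuantumFieldTheory.StochasticAcceptanceGaussian
import HarnessLib

/-!
# Knechtli–Wolff: the partially stochastic (PSD) acceptance for a given spectrum and its detailed balance

Topic `MathematicalPhysics/QuantumFieldTheory`; sequel of `StochasticAcceptanceSpectrum.lean` /
`StochasticAcceptanceGaussian.lean` (Knechtli–Wolff §4.1 (4.11)–(4.14): the FULLY stochastic
acceptance `⟨w₀⟩_η`, i.e. the case `S = ∅` below) and of `PseudofermionIntegral.lean` ((4.1)–(4.9)).
PUBLISHED RESULTS, proved here (no named fact is introduced, D-0026); wanted by the cell pub-lqcd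
(venture `LatticeQCDFlow`, HOME/R2-SCOPE.md §2 row G1 "PSD: a few extremal generalized eigenvalues
treated exactly, the rest stochastically", §3 E2 determinant routes D0/D1; the docstring of
`StochasticAcceptanceSpectrum.lean` records "the partially stochastic case `S ≠ ∅` … NOT formalised").

The statements as printed.  Knechtli–Wolff, *Dynamical fermions as a global correction*, Nucl.
Phys. B 663 (2003) 3, §4: "we shall thus derive a family of (exact) algorithms which contains those
based on exact and on fully stochastic determinants as extremal cases between which we interpolate";
§4.3 (4.36): the partially stochastic acceptance
`w_s(A,A') = min[1, ∏_{i∈S} λᵢ⁻¹ exp(−η†P̄(M†M − 1)P̄η)]`, `S` the set of exactly treated eigenvalues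
`λᵢ` of `M†M`, `P̄` the projector onto the span of the remaining eigenvectors; Appendix A
("Acceptance rate for given spectrum"): "In this appendix we evaluate the integral
`F(λᵢ) = ∏_{i∈S̄}(∫₀^∞ duᵢ) min[exp(−Σ_{i∈S̄} uᵢ), ∏_{i∈S} λᵢ⁻¹ exp(−Σ_{i∈S̄} λᵢuᵢ)]` (A.1).
Eigenvalues `0 < λᵢ < ∞, i = 1…n` enter here and `S` is a subset of their indices which may also be
empty.  The set `S̄` comprises the remaining indices. … By rescaling integrals the full result is
obtained as `F(λᵢ) = f(λᵢ) + (∏ᵢλᵢ⁻¹) f(λᵢ⁻¹)` (A.4), a form which immediately reflects detailed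
balance in the form `F(λᵢ)/F(λᵢ⁻¹) = ∏ᵢ λᵢ⁻¹` (A.5). … For `S̄ = ∅` we recognize the deterministic
acceptance `min[1, ∏ₖλₖ⁻¹]`.  For the fully stochastic case `S = ∅` we … obtain (4.13)."

What is proved here (finite form; `ι` indexes ALL eigenvalues, `S : Finset ι` the exact ones,
`Sᶜ = S̄` the stochastic ones; as in `StochasticAcceptanceSpectrum.lean` the weights
`∏ (∫₀^∞ duᵢ e^{−uᵢ})` are written as the product probability `⊗ᵢ Exp(1)` — the integrations over
the `i ∈ S` coordinates, absent from (A.1), are `∫₀^∞ e^{−u} du = 1` each and change nothing; they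
are exactly what the `η`-average of (4.36)–(4.38) produces before they are dropped; equation
numbers are those PRINTED in the arXiv version, read from its PDF):
* `psdF lam S` — Knechtli–Wolff's `F(λ; S) = E[min(1, ∏_{i∈S}λᵢ⁻¹ · exp(−Σ_{i∈S̄}(λᵢ − 1)uᵢ))]`,
  `uᵢ` i.i.d. `Exp(1)` (A.1); `psdF_eq_setIntegral` : (A.1) as a Lebesgue integral over the orthant,
  `∫_{[0,∞)^ι} min[e^{−Σᵢuᵢ}, ∏_{i∈S}λᵢ⁻¹ e^{−Σ_{i∈S}uᵢ − Σ_{i∈S̄}λᵢuᵢ}] du`;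
* **`psdF_eq_inv_prod_mul_psdF_inv`** — DETAILED BALANCE FOR A GIVEN SPECTRUM (A.5), "by rescaling
  integrals": `F(λ; S) = (∏ᵢ λᵢ)⁻¹ · F(λ⁻¹; S)` for all `λᵢ > 0` and every `S` (no non-degeneracy
  needed), and `psdF_div_psdF_inv` : `F(λ; S)/F(λ⁻¹; S) = ∏ᵢ λᵢ⁻¹`;
* `psdF_univ` : `S̄ = ∅` gives "the deterministic acceptance `min[1, ∏ₖλₖ⁻¹]`"; `psdF_empty`,
  `psdF_empty_eq_sum` : `S = ∅` gives the fully stochastic `⟨w₀⟩_η` of (4.13)–(4.14)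
  (`integral_pi_min_one_exp_neg_sum` of `StochasticAcceptanceSpectrum.lean`);
* `psdF_pos`, `psdF_le_one`, `psdF_le_min` : `0 < F(λ; S) ≤ min(1, ∏ᵢλᵢ⁻¹)` — by (A.5) the
  exact-determinant ("Carnot", §4.1 after (4.9)) acceptance bounds every member of the family;
  `twoStep_le_psdF` : §4.3 footnote 5 — two successive Metropolis steps (exact factor, then stochastic
  factor) accept on average at most as often as the combined criterion (4.36).
Tools: `expMeasure_eq_withDensity_expMeasure_one` (`Exp(r) = r e^{−(r−1)v} · Exp(1)`),
`pi_expMeasure_eq_withDensity`, `map_scale_pi_expMeasure_one` (the rescaling `uᵢ ↦ cᵢuᵢ` maps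
`⊗Exp(1)` to `⊗Exp(1/cᵢ)`; Mathlib's `Measure.pi_map_pi`).

The matrix-level statements of §4.3 ((4.29)–(4.40): the projector `P = Σ_{i∈S} φᵢφᵢ†`, the
acceptance `w_s(A,A')`, `⟨w_s(A,A')⟩_η / ⟨w_s(A',A)⟩_η = |det M|⁻²`) are the sequel
`PartiallyStochasticDetailedBalance.lean`; the closed form (A.16) (both signs of `C = Σ_{i∈S} ln λᵢ`),
(A.17)–(A.18) and the two-eigenvalue example (4.15) are the sequel
`PartiallyStochasticAcceptanceFormula.lean`; the decomposition (A.2)–(A.4) into `f` and the contour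
road (A.6)–(A.8) are NOT formalised — TODO(general form).

## References
* [KnechtliWolff2003] F. Knechtli, U. Wolff, Dynamical fermions as a global correction, Nucl. Phys.
  B 663 (2003) 3–32 (= hep-lat/0303001, whose printed equation numbers are used), §4.1 (4.9),
  (4.13)–(4.14); §4.3 (4.36)–(4.40); Appendix A (A.1)–(A.5), (A.16)–(A.17) and the remark after (A.17).
* [BuchholzKriegeFelko2014] P. Buchholz, J. Kriege, I. Felko, Input Modeling with Phase-Type
  Distributions and Markov Models, Springer 2014, Ch. 2 (the exponential law, before eq. (2.24)).
-/

namespace Literature.MathematicalPhysics.QuantumFieldTheory.StochasticAcceptance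

open MeasureTheory ProbabilityTheory Set Real
open Literature.Probability.Distributions
open scoped ENNReal

/-! ## `Exp(r)` relative to `Exp(1)`; rescaling the product law -/

section ExpDensity

/-- The real exponential density: `r e^{−rx}` on `x ≥ 0`, `0` on `x < 0`. [folklore] -/
private theorem exponentialPDFReal_eq_ite (r x : ℝ) :
    exponentialPDFReal r x = if 0 ≤ x then r * Real.exp (-(r * x)) else 0 := by
  simp only [exponentialPDFReal, gammaPDFReal, Real.rpow_one, Real.Gamma_one, div_one, sub_self,
    Real.rpow_zero, mul_one]

/-- `Exp(1)` is a probability law. [folklore] -/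
private theorem isProbabilityMeasure_expMeasure_one' : IsProbabilityMeasure (expMeasure 1) :=
  isProbabilityMeasure_expMeasure one_pos

attribute [local instance] isProbabilityMeasure_expMeasure_one'

/-- **`Exp(r)` has density `r e^{−(r−1)v}` with respect to `Exp(1)`** (`r e^{−rv} = r e^{−(r−1)v}·e^{−v}`
on `v ≥ 0`). [cite: BuchholzKriegeFelko2014, Ch. 2 (densities `fᵢ(x) = λ(i)e^{−λ(i)x}`, before (2.24))];
[folklore] -/
theorem expMeasure_eq_withDensity_expMeasure_one {r : ℝ} (hr : 0 < r) :
    expMeasure r = (expMeasure 1).withDensity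
      (fun v => ENNReal.ofReal (r * Real.exp (-((r - 1) * v)))) := by
  have hg : Measurable fun v : ℝ => ENNReal.ofReal (r * Real.exp (-((r - 1) * v))) := by fun_prop
  have hf : Measurable (exponentialPDF 1) := (measurable_exponentialPDFReal 1).ennreal_ofReal
  rw [Hypoexponential.expMeasure_eq_withDensity r, Hypoexponential.expMeasure_eq_withDensity 1,
    ← withDensity_mul _ hf hg]
  congr 1
  funext v
  simp only [Pi.mul_apply, exponentialPDF, exponentialPDFReal_eq_ite]
  split_ifs with h
  · rw [← ENNReal.ofReal_mul (by positivity)]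
    congr 1
    rw [one_mul, one_mul, mul_left_comm, ← Real.exp_add]
    congr 2
    ring
  · simp [hr.le]

variable {ι : Type*} [Fintype ι]

/-- **The product law `⊗ᵢ Exp(rᵢ)` has density `∏ᵢ rᵢ e^{−(rᵢ−1)vᵢ}` with respect to `⊗ᵢ Exp(1)`**
(product of `expMeasure_eq_withDensity_expMeasure_one`; the Jacobian-times-weight factor of the
substitution `uᵢ = vᵢ/λᵢ` "by rescaling integrals"). [cite: KnechtliWolff2003, App. A (A.4)];
[cite: BuchholzKriegeFelko2014, Ch. 2 (before (2.24))]; [folklore] -/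
theorem pi_expMeasure_eq_withDensity (r : ι → ℝ) (hr : ∀ i, 0 < r i) :
    Measure.pi (fun i => expMeasure (r i)) = (Measure.pi fun _ : ι => expMeasure 1).withDensity
      (fun v => ∏ i, ENNReal.ofReal (r i * Real.exp (-((r i - 1) * v i)))) := by
  have hf : ∀ i, Measurable fun v : ℝ => ENNReal.ofReal (r i * Real.exp (-((r i - 1) * v))) :=
    fun i => by fun_prop
  haveI : ∀ i, SigmaFinite ((expMeasure 1).withDensity
      fun v : ℝ => ENNReal.ofReal (r i * Real.exp (-((r i - 1) * v)))) := fun i => by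
    rw [← expMeasure_eq_withDensity_expMeasure_one (hr i)]
    haveI := isProbabilityMeasure_expMeasure (hr i)
    infer_instance
  have h := GaussianToolkit.pi_withDensity (fun _ : ι => expMeasure 1)
    (fun i v => ENNReal.ofReal (r i * Real.exp (-((r i - 1) * v)))) hf
  have hfun : (fun i => expMeasure (r i)) = fun i => (expMeasure 1).withDensity
      fun v => ENNReal.ofReal (r i * Real.exp (-((r i - 1) * v))) :=
    funext fun i => expMeasure_eq_withDensity_expMeasure_one (hr i)
  rw [hfun, h]

/-- **Rescaling coordinates**: for `cᵢ > 0` the map `u ↦ (cᵢuᵢ)ᵢ` pushes `⊗ᵢ Exp(1)` to `⊗ᵢ Exp(1/cᵢ)`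
("by rescaling integrals"). [cite: KnechtliWolff2003, App. A (A.4)]; [folklore] -/
theorem map_scale_pi_expMeasure_one (c : ι → ℝ) (hc : ∀ i, 0 < c i) :
    (Measure.pi fun _ : ι => expMeasure 1).map (fun u i => c i * u i)
      = Measure.pi fun i => expMeasure (c i)⁻¹ := by
  haveI : ∀ i, SigmaFinite ((expMeasure (1 : ℝ)).map fun x : ℝ => c i * x) := fun i => by
    rw [map_const_mul_expMeasure one_pos (hc i)]
    haveI := isProbabilityMeasure_expMeasure (div_pos one_pos (hc i))
    infer_instance
  rw [Measure.pi_map_pi (fun i => (measurable_const_mul (c i)).aemeasurable)]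
  congr 1
  funext i
  rw [map_const_mul_expMeasure one_pos (hc i), one_div]

end ExpDensity

/-! ## Knechtli–Wolff's `F(λ; S)` (A.1) and its detailed balance (A.5) -/

section PSD

variable {ι : Type*} [Fintype ι] [DecidableEq ι]

attribute [local instance] isProbabilityMeasure_expMeasure_one'

/-- **Knechtli–Wolff's acceptance rate for a given spectrum, `F(λ; S)`** — the `η`-average of the
partially stochastic acceptance (4.36) when `M†M` has eigenvalues `λᵢ`, the ones indexed by `S`
treated exactly and the others (`S̄ = Sᶜ`) stochastically:
`F(λ; S) = E[min(1, ∏_{i∈S} λᵢ⁻¹ · exp(−Σ_{i∈S̄} (λᵢ − 1) uᵢ))]`, `uᵢ` i.i.d. `Exp(1)`, i.e.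
`∏ᵢ(∫₀^∞duᵢ e^{−uᵢ}) min[1, ∏_{i∈S}λᵢ⁻¹ exp(−Σ_{i∈S̄}(λᵢ−1)uᵢ)]` — (A.1) with `min[e^{−Σu}, ·]`
written as `e^{−Σu} min[1, ·]`. [cite: KnechtliWolff2003, App. A eq. (A.1); §4.3 eq. (4.36)] -/
noncomputable def psdF (lam : ι → ℝ) (S : Finset ι) : ℝ :=
  ∫ u, min 1 ((∏ i ∈ S, lam i)⁻¹ * Real.exp (-(∑ i ∈ Sᶜ, (lam i - 1) * u i)))
    ∂(Measure.pi fun _ : ι => expMeasure 1)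

omit [DecidableEq ι] in
/-- `⊗ᵢ Exp(1) = (∏ᵢ e^{−uᵢ} 1{uᵢ ≥ 0}) du` on `ℝ^ι`. [folklore] -/
private theorem pi_expMeasure_one_eq_withDensity :
    Measure.pi (fun _ : ι => expMeasure 1)
      = (volume : Measure (ι → ℝ)).withDensity fun u => ∏ i, exponentialPDF 1 (u i) := by
  haveI : SigmaFinite ((volume : Measure ℝ).withDensity (exponentialPDF 1)) := by
    change SigmaFinite (expMeasure 1); infer_instance
  have h := GaussianToolkit.pi_withDensity (fun _ : ι => (volume : Measure ℝ))
    (fun _ => exponentialPDF 1) (fun _ => (measurable_exponentialPDFReal 1).ennreal_ofReal)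
  rw [volume_pi]
  exact h

/-- The integrand of `F(λ; S)` is measurable. [folklore] -/
private theorem measurable_psd_integrand (lam : ι → ℝ) (S : Finset ι) :
    Measurable fun u : ι → ℝ =>
      min 1 ((∏ i ∈ S, lam i)⁻¹ * Real.exp (-(∑ i ∈ Sᶜ, (lam i - 1) * u i))) := by
  fun_prop

/-- **(A.1) as printed, as a Lebesgue integral over the orthant**:
`F(λ; S) = ∫_{[0,∞)^ι} min[exp(−Σᵢ uᵢ), ∏_{i∈S} λᵢ⁻¹ exp(−Σ_{i∈S} uᵢ − Σ_{i∈S̄} λᵢ uᵢ)] du`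
(the `i ∈ S` integrations contribute the factor `∫₀^∞ e^{−u} du = 1` each).
[cite: KnechtliWolff2003, App. A eq. (A.1)] -/
theorem psdF_eq_setIntegral (lam : ι → ℝ) (S : Finset ι) :
    psdF lam S = ∫ u in Set.pi Set.univ (fun _ : ι => Ici (0 : ℝ)),
      min (Real.exp (-(∑ i, u i)))
        ((∏ i ∈ S, lam i)⁻¹ * Real.exp (-(∑ i ∈ S, u i + ∑ i ∈ Sᶜ, lam i * u i))) := by
  have hdm : Measurable fun u : ι → ℝ => ∏ i, exponentialPDF 1 (u i) :=
    Finset.measurable_prod _ fun i _ =>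
      ((measurable_exponentialPDFReal 1).ennreal_ofReal).comp (measurable_pi_apply i)
  rw [psdF, pi_expMeasure_one_eq_withDensity,
    integral_withDensity_eq_integral_toReal_smul hdm (ae_of_all _ fun u => by
      simp [exponentialPDF, ENNReal.prod_lt_top]),
    ← integral_indicator (MeasurableSet.univ_pi fun _ => measurableSet_Ici)]
  refine integral_congr_ae (ae_of_all _ fun u => ?_)
  simp only [smul_eq_mul]
  by_cases h : u ∈ Set.pi Set.univ (fun _ : ι => Ici (0 : ℝ))
  · rw [Set.indicator_of_mem h]
    have h' : ∀ i, 0 ≤ u i := fun i => Set.mem_univ_pi.mp h i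
    have hprod : (∏ i, exponentialPDF 1 (u i)).toReal = Real.exp (-(∑ i, u i)) := by
      rw [ENNReal.toReal_prod, ← Finset.sum_neg_distrib, Real.exp_sum]
      refine Finset.prod_congr rfl fun i _ => ?_
      rw [exponentialPDF, exponentialPDFReal_eq_ite, if_pos (h' i), one_mul, one_mul,
        ENNReal.toReal_ofReal (Real.exp_pos _).le]
    rw [hprod, mul_min_of_nonneg _ _ (Real.exp_pos _).le, mul_one, mul_left_comm, ← Real.exp_add]
    congr 3
    have hs : ∑ i ∈ Sᶜ, (lam i - 1) * u i = ∑ i ∈ Sᶜ, lam i * u i - ∑ i ∈ Sᶜ, u i := by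
      rw [← Finset.sum_sub_distrib]
      exact Finset.sum_congr rfl fun i _ => by ring
    rw [hs, ← Finset.sum_add_sum_compl S u]
    ring
  · rw [Set.indicator_of_notMem h]
    have h' : ¬ ∀ i, 0 ≤ u i := fun h'' => h (Set.mem_univ_pi.mpr fun i => h'' i)
    obtain ⟨i, hi⟩ := not_forall.mp h'
    rw [Finset.prod_eq_zero (Finset.mem_univ i)
      (by rw [exponentialPDF, exponentialPDFReal_eq_ite, if_neg hi, ENNReal.ofReal_zero])]
    simp

/-- `S̄ = ∅` (all eigenvalues exact): **"we recognize the deterministic acceptance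
`min[1, ∏ₖ λₖ⁻¹]`"** (`∏ₖλₖ⁻¹ = |det M|⁻²`, the exact-determinant Metropolis acceptance of
§3.1). [cite: KnechtliWolff2003, App. A (remark after (A.17)); §3.1 eq. (3.1)] -/
theorem psdF_univ (lam : ι → ℝ) : psdF lam Finset.univ = min 1 (∏ i, lam i)⁻¹ := by
  rw [psdF, Finset.compl_univ]
  simp

/-- `S = ∅` (fully stochastic case): `F(λ; ∅) = E[min(1, exp(−Σᵢ(λᵢ − 1)uᵢ))] = ⟨w₀⟩_η` of
(4.13). [cite: KnechtliWolff2003, App. A (A.1) with `S = ∅`, §4.1 (4.13)] -/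
theorem psdF_empty (lam : ι → ℝ) :
    psdF lam ∅ = ∫ u, min 1 (Real.exp (-(∑ i, (lam i - 1) * u i)))
      ∂(Measure.pi fun _ : ι => expMeasure 1) := by
  rw [psdF]
  simp only [Finset.prod_empty, inv_one, one_mul, Finset.compl_empty]

/-- `S = ∅`: **"for the fully stochastic case `S = ∅` we … obtain (4.14)"**,
`F(λ; ∅) = Σᵢ min(1, 1/λᵢ) ∏_{j≠i} (λᵢ − 1)/(λᵢ − λⱼ)` for pairwise distinct `λᵢ ≠ 1`, `n ≥ 1`.
[cite: KnechtliWolff2003, App. A (A.16)–(A.18), §4.1 (4.14)] -/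
theorem psdF_empty_eq_sum [Nonempty ι] {lam : ι → ℝ} (hpos : ∀ i, 0 < lam i)
    (hne : ∀ i, lam i ≠ 1) (hinj : Function.Injective lam) :
    psdF lam ∅ = ∑ i, min 1 (lam i)⁻¹ * kwWeight lam i := by
  rw [psdF_empty]
  exact integral_pi_min_one_exp_neg_sum hpos hne hinj

/-- The integrand of `F(λ; S)` is positive when the exact eigenvalues are. [folklore] -/
private theorem psd_integrand_pos {lam : ι → ℝ} {S : Finset ι} (hS : ∀ i ∈ S, 0 < lam i)
    (u : ι → ℝ) : 0 < min 1 ((∏ i ∈ S, lam i)⁻¹ * Real.exp (-(∑ i ∈ Sᶜ, (lam i - 1) * u i))) :=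
  lt_min one_pos (mul_pos (inv_pos.mpr (Finset.prod_pos hS)) (Real.exp_pos _))

/-- The integrand of `F(λ; S)` is integrable (bounded by `1` under a probability law). [folklore] -/
private theorem integrable_psd_integrand {lam : ι → ℝ} {S : Finset ι} (hS : ∀ i ∈ S, 0 < lam i) :
    Integrable (fun u : ι → ℝ =>
      min 1 ((∏ i ∈ S, lam i)⁻¹ * Real.exp (-(∑ i ∈ Sᶜ, (lam i - 1) * u i))))
      (Measure.pi fun _ : ι => expMeasure 1) :=
  Integrable.mono' (integrable_const (1 : ℝ)) (measurable_psd_integrand lam S).aestronglyMeasurable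
    (ae_of_all _ fun u => by
      rw [Real.norm_eq_abs, abs_of_pos (psd_integrand_pos hS u)]
      exact min_le_left _ _)

/-- `F(λ; S) > 0`. [cite: KnechtliWolff2003, App. A (A.1) ("eigenvalues `0 < λᵢ < ∞`")] -/
theorem psdF_pos {lam : ι → ℝ} {S : Finset ι} (hS : ∀ i ∈ S, 0 < lam i) : 0 < psdF lam S := by
  rw [psdF, integral_pos_iff_support_of_nonneg_ae (ae_of_all _ fun u => (psd_integrand_pos hS u).le)
    (integrable_psd_integrand hS)]
  have hsupp : Function.support (fun u : ι → ℝ =>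
      min 1 ((∏ i ∈ S, lam i)⁻¹ * Real.exp (-(∑ i ∈ Sᶜ, (lam i - 1) * u i)))) = Set.univ :=
    Set.eq_univ_of_forall fun u => (psd_integrand_pos hS u).ne'
  rw [hsupp, measure_univ]
  exact zero_lt_one

/-- `F(λ; S) ≤ 1`. [cite: KnechtliWolff2003, App. A (A.1)] -/
theorem psdF_le_one {lam : ι → ℝ} {S : Finset ι} (hS : ∀ i ∈ S, 0 < lam i) : psdF lam S ≤ 1 := by
  rw [psdF]
  calc _ ≤ ∫ _u, (1 : ℝ) ∂(Measure.pi fun _ : ι => expMeasure 1) :=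
        integral_mono (integrable_psd_integrand hS) (integrable_const _) fun u => min_le_left _ _
    _ = 1 := by simp

/-- The one-line algebra of "rescaling integrals": with `P = ∏_{i∈S}λᵢ`, `Q = ∏_{i∈S̄}λᵢ` and
`A = Σ_{i∈S̄}(1 − λᵢ⁻¹)vᵢ`,  `Q⁻¹e^{A} · min(1, P⁻¹e^{−A}) = (PQ)⁻¹ · min(1, P e^{A})`. [folklore] -/
private theorem rescale_min {P Q : ℝ} (hP : 0 < P) (hQ : 0 < Q) (A : ℝ) :
    Q⁻¹ * Real.exp A * min 1 (P⁻¹ * Real.exp (-A)) = (P * Q)⁻¹ * min 1 (P * Real.exp A) := by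
  have hE : Real.exp A ≠ 0 := (Real.exp_pos A).ne'
  have hP' : P ≠ 0 := hP.ne'
  have hQ' : Q ≠ 0 := hQ.ne'
  rw [Real.exp_neg, mul_min_of_nonneg _ _ (by positivity : 0 ≤ Q⁻¹ * Real.exp A),
    mul_min_of_nonneg _ _ (by positivity : 0 ≤ (P * Q)⁻¹)]
  have e1 : Q⁻¹ * Real.exp A * 1 = (P * Q)⁻¹ * (P * Real.exp A) := by field_simp
  have e2 : Q⁻¹ * Real.exp A * (P⁻¹ * (Real.exp A)⁻¹) = (P * Q)⁻¹ * 1 := by field_simp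
  rw [e1, e2, min_comm]

/-- **KNECHTLI–WOLFF (A.5): DETAILED BALANCE OF THE PARTIALLY STOCHASTIC ACCEPTANCE FOR A GIVEN
SPECTRUM.**  For all eigenvalues `λᵢ > 0` and every set `S` of exactly treated ones,
`F(λ; S) = (∏ᵢ λᵢ)⁻¹ · F(λ⁻¹; S)` — "By rescaling integrals … a form which immediately reflects
detailed balance in the form `F(λᵢ)/F(λᵢ⁻¹) = ∏ᵢ λᵢ⁻¹`" (the reverse move has `M → M⁻¹`, hence the
reciprocal spectrum, and `∏ᵢ λᵢ = det M†M = |det M|²`).  Proof as printed: substitute `uᵢ = vᵢ/λᵢ`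
for `i ∈ S̄`; under `⊗Exp(1)` this is the density `∏_{i∈S̄} λᵢ⁻¹ e^{(1−1/λᵢ)vᵢ}` of `⊗ᵢExp(1/λᵢ)`
(`pi_expMeasure_eq_withDensity`), and
`λ_{S̄}⁻¹ e^{Σ(1−1/λᵢ)vᵢ} min[1, λ_S⁻¹ e^{−Σ(1−1/λᵢ)vᵢ}] = (∏λ)⁻¹ min[1, λ_S e^{−Σ(1/λᵢ−1)vᵢ}]`.
[cite: KnechtliWolff2003, App. A eqs. (A.4)–(A.5); §4.3 eq. (4.40)] -/
theorem psdF_eq_inv_prod_mul_psdF_inv {lam : ι → ℝ} (hpos : ∀ i, 0 < lam i) (S : Finset ι) :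
    psdF lam S = (∏ i, lam i)⁻¹ * psdF (fun i => (lam i)⁻¹) S := by
  -- the rescaling `uᵢ ↦ λᵢuᵢ` on `S̄`, the identity on `S`
  set c : ι → ℝ := fun i => if i ∈ S then 1 else lam i with hc
  have hc_pos : ∀ i, 0 < c i := fun i => by
    simp only [hc]; split_ifs
    · exact one_pos
    · exact hpos i
  have hcS : ∀ i ∈ S, c i = 1 := fun i hi => by simp [hc, hi]
  have hcSc : ∀ i ∈ Sᶜ, c i = lam i := fun i hi => by simp [hc, Finset.mem_compl.mp hi]
  set P : ℝ := ∏ i ∈ S, lam i with hP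
  have hPpos : 0 < P := Finset.prod_pos fun i _ => hpos i
  have hQpos : 0 < ∏ i ∈ Sᶜ, lam i := Finset.prod_pos fun i _ => hpos i
  -- the integrand in the rescaled variables `v = (cᵢuᵢ)ᵢ`
  set g : (ι → ℝ) → ℝ := fun v =>
    min 1 (P⁻¹ * Real.exp (-(∑ i ∈ Sᶜ, (1 - (lam i)⁻¹) * v i))) with hg
  have hgm : Measurable g := by simp only [hg]; fun_prop
  have hT : Measurable fun u : ι → ℝ => fun i => c i * u i := by fun_prop
  -- Step 1: `F(λ; S) = ∫ g d(⊗ᵢ Exp(1/cᵢ))`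
  have h1 : psdF lam S = ∫ v, g v ∂(Measure.pi fun i => expMeasure (c i)⁻¹) := by
    rw [← map_scale_pi_expMeasure_one c hc_pos,
      integral_map hT.aemeasurable hgm.aestronglyMeasurable, psdF]
    refine integral_congr_ae (ae_of_all _ fun u => ?_)
    simp only [hg]
    have hsum : ∑ i ∈ Sᶜ, (lam i - 1) * u i = ∑ i ∈ Sᶜ, (1 - (lam i)⁻¹) * (c i * u i) := by
      refine Finset.sum_congr rfl fun i hi => ?_
      rw [hcSc i hi, sub_mul, sub_mul, one_mul, one_mul, ← mul_assoc,
        inv_mul_cancel₀ (hpos i).ne', one_mul]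
    rw [hsum]
  -- Step 2: the density of `⊗ᵢ Exp(1/cᵢ)` with respect to `⊗ᵢ Exp(1)`
  have h2 : ∫ v, g v ∂(Measure.pi fun i => expMeasure (c i)⁻¹)
      = ∫ v, (∏ i, ENNReal.ofReal ((c i)⁻¹ * Real.exp (-(((c i)⁻¹ - 1) * v i)))).toReal * g v
          ∂(Measure.pi fun _ : ι => expMeasure 1) := by
    rw [pi_expMeasure_eq_withDensity (fun i => (c i)⁻¹) (fun i => inv_pos.mpr (hc_pos i)),
      integral_withDensity_eq_integral_toReal_smul (by fun_prop)
        (ae_of_all _ fun v => by simp [ENNReal.prod_lt_top])]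
    rfl
  -- Step 3: the pointwise identity
  have h3 : ∀ v : ι → ℝ,
      (∏ i, ENNReal.ofReal ((c i)⁻¹ * Real.exp (-(((c i)⁻¹ - 1) * v i)))).toReal * g v
        = (∏ i, lam i)⁻¹ * min 1 ((∏ i ∈ S, (fun i => (lam i)⁻¹) i)⁻¹ *
            Real.exp (-(∑ i ∈ Sᶜ, ((fun i => (lam i)⁻¹) i - 1) * v i))) := by
    intro v
    have hdens : (∏ i, ENNReal.ofReal ((c i)⁻¹ * Real.exp (-(((c i)⁻¹ - 1) * v i)))).toReal
        = (∏ i ∈ Sᶜ, lam i)⁻¹ * Real.exp (∑ i ∈ Sᶜ, (1 - (lam i)⁻¹) * v i) := by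
      rw [ENNReal.toReal_prod]
      have ht : ∀ i, (ENNReal.ofReal ((c i)⁻¹ * Real.exp (-(((c i)⁻¹ - 1) * v i)))).toReal
          = (c i)⁻¹ * Real.exp (-(((c i)⁻¹ - 1) * v i)) := fun i =>
        ENNReal.toReal_ofReal (le_of_lt (mul_pos (inv_pos.mpr (hc_pos i)) (Real.exp_pos _)))
      simp_rw [ht]
      rw [← Finset.prod_mul_prod_compl S]
      have hS1 : ∏ i ∈ S, (c i)⁻¹ * Real.exp (-(((c i)⁻¹ - 1) * v i)) = 1 :=
        Finset.prod_eq_one fun i hi => by rw [hcS i hi]; simp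
      rw [hS1, one_mul, Real.exp_sum, ← Finset.prod_inv_distrib, ← Finset.prod_mul_distrib]
      refine Finset.prod_congr rfl fun i hi => ?_
      rw [hcSc i hi]
      congr 2
      ring
    rw [hdens, hg]
    simp only
    have hA : ∑ i ∈ Sᶜ, ((lam i)⁻¹ - 1) * v i = -(∑ i ∈ Sᶜ, (1 - (lam i)⁻¹) * v i) := by
      rw [← Finset.sum_neg_distrib]
      exact Finset.sum_congr rfl fun i _ => by ring
    rw [hA, neg_neg, Finset.prod_inv_distrib, inv_inv, ← Finset.prod_mul_prod_compl S lam]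
    exact rescale_min hPpos hQpos _
  -- assemble
  rw [h1, h2]
  simp_rw [h3]
  rw [integral_const_mul, psdF]

/-- **(A.5) as printed, in ratio form**: `F(λ; S) / F(λ⁻¹; S) = ∏ᵢ λᵢ⁻¹`.
[cite: KnechtliWolff2003, App. A eq. (A.5)] -/
theorem psdF_div_psdF_inv {lam : ι → ℝ} (hpos : ∀ i, 0 < lam i) (S : Finset ι) :
    psdF lam S / psdF (fun i => (lam i)⁻¹) S = (∏ i, lam i)⁻¹ := by
  have hne : psdF (fun i => (lam i)⁻¹) S ≠ 0 :=
    (psdF_pos (S := S) (lam := fun i => (lam i)⁻¹) fun i _ => inv_pos.mpr (hpos i)).ne'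
  rw [psdF_eq_inv_prod_mul_psdF_inv hpos S, mul_div_assoc, div_self hne, mul_one]

/-- **Every member of the family is bounded by the exact-determinant acceptance**:
`F(λ; S) ≤ min(1, ∏ᵢ λᵢ⁻¹)` — by (A.5) and `F ≤ 1`; for `S = ∅` this is the "Carnot" bound (4.9),
for `S̄ = ∅` an equality (`psdF_univ`).
[cite: KnechtliWolff2003, §4.1 eq. (4.9) and the sentence after it; App. A eq. (A.5)] -/
theorem psdF_le_min {lam : ι → ℝ} (hpos : ∀ i, 0 < lam i) (S : Finset ι) :
    psdF lam S ≤ min 1 (∏ i, lam i)⁻¹ := by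
  refine le_min (psdF_le_one fun i _ => hpos i) ?_
  rw [psdF_eq_inv_prod_mul_psdF_inv hpos S]
  exact mul_le_of_le_one_right (inv_nonneg.mpr (Finset.prod_nonneg fun i _ => (hpos i).le))
    (psdF_le_one fun i _ => inv_pos.mpr (hpos i))

/-- `min(1,a)·min(1,b) ≤ min(1,ab)` for `a, b ≥ 0`. [folklore] -/
private theorem min_one_mul_min_one_le {a b : ℝ} (ha : 0 ≤ a) (hb : 0 ≤ b) :
    min 1 a * min 1 b ≤ min 1 (a * b) :=
  le_min (mul_le_one₀ (min_le_left _ _) (le_min zero_le_one hb) (min_le_left _ _))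
    (mul_le_mul (min_le_right _ _) (min_le_right _ _) (le_min zero_le_one hb) ha)

/-- The stochastic factor alone, `min[1, exp(−Σ_{i∈S̄}(λᵢ − 1)uᵢ)]`, is integrable under `⊗Exp(1)`
(bounded by `1`). [folklore] -/
private theorem integrable_min_one_exp_neg_finsetSum (lam : ι → ℝ) (S : Finset ι) :
    Integrable (fun u : ι → ℝ => min 1 (Real.exp (-(∑ i ∈ Sᶜ, (lam i - 1) * u i))))
      (Measure.pi fun _ : ι => expMeasure 1) :=
  Integrable.mono' (integrable_const (1 : ℝ))
    (Measurable.aestronglyMeasurable (by fun_prop))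
    (ae_of_all _ fun u => by
      rw [Real.norm_eq_abs, abs_of_pos (lt_min one_pos (Real.exp_pos _))]
      exact min_le_left _ _)

/-- **§4.3, footnote 5: "One could also think of two separate successive Metropolis steps, but this
leads to smaller overall acceptance rates."**  Filtering first through the exact factor (acceptance
`min[1, ∏_{i∈S}λᵢ⁻¹]`, cf. (4.35)) and then through the stochastic factor alone (the display before
(4.36): `min[1, exp(−η†P̄(M†M − 1)P̄η)]`, mean `E[min(1, exp(−Σ_{i∈S̄}(λᵢ − 1)uᵢ))]`) accepts on average
AT MOST as often as the combined criterion (4.36): `min(1,a)·min(1,b) ≤ min(1,ab)` pointwise.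
[cite: KnechtliWolff2003, §4.3 footnote 5 and the display before eq. (4.36)] -/
theorem twoStep_le_psdF {lam : ι → ℝ} {S : Finset ι} (hS : ∀ i ∈ S, 0 < lam i) :
    min 1 (∏ i ∈ S, lam i)⁻¹ *
        ∫ u, min 1 (Real.exp (-(∑ i ∈ Sᶜ, (lam i - 1) * u i)))
          ∂(Measure.pi fun _ : ι => expMeasure 1)
      ≤ psdF lam S := by
  rw [← integral_const_mul, psdF]
  refine integral_mono ((integrable_min_one_exp_neg_finsetSum lam S).const_mul _)
    (integrable_psd_integrand hS) fun u => ?_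
  exact min_one_mul_min_one_le (inv_nonneg.mpr (Finset.prod_nonneg fun i hi => (hS i hi).le))
    (Real.exp_pos _).le

end PSD

end Literature.MathematicalPhysics.QuantumFieldTheory.StochasticAcceptance
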